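import Mathlib

/-!
# Crux `SelmerRankUB` (stmt-BirchSwinnertonDyer-0130) — ideate census r1/k2, typed companion

Obstruction-side lemma for census item §2 ("the Perrin-Riou height PENCIL at an ordinary prime"):
the `p`-adic heights attached to splittings `ν` of the Hodge filtration form an affine pencil
`h_ν = h_α + t(ν) · (log_ω ⊗ log_ω)` (Perrin-Riou 2003 §2; Büyükboduk–Pollack–Sasaki 2018 §6.1.1),
so on a rank-2 lattice with Gram matrix `A = (a b; b c)` for `h_α` and logarithm vector `(x, y)` the
regulator of `h_ν` is AFFINE-LINEAR in `t`:  `det(A + t·vvᵀ) = det A + t·(c x² − 2 b x y + a y²)`,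
and the second coefficient is `h_α(Q,Q)` for `Q = y·P₁ − x·P₂`, the generator of the STRICT
Mordell–Weil line `ker(log_ω ∘ res_p)`.  Hence every member of the pencil is degenerate iff
`Reg_α = 0 ∧ h_α(Q,Q) = 0` — two independent conditions (codimension 2), in contrast with rank 1
where the pencil always contains a totally degenerate member.  (This is the rank-2 face of the
barrier entry `PAdicHeightBarrierNarrow`, conjunct (2), and of Castella 2025 Thm 1's strict
regulator.)  It is recorded to make precise WHY the two-refinement Kato line
(`s_p ≤ min(ord_T L_p(f,α,T), ord_T L_p(f,β,T))`) buys a weaker non-degeneracy than Schneider's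
but still only the identity "p-adic order = rank", never "rank ≤ r_an" (census §2).
-/

namespace Summit.BirchSwinnertonDyer.BirchSwinnertonDyer.Cruxes.SelmerRankUB.IdeateR1K2

open Matrix

variable {K : Type*}

/-- Gram matrix of a symmetric pairing on a rank-2 lattice. -/
abbrev gram [CommRing K] (a b c : K) : Matrix (Fin 2) (Fin 2) K := !![a, b; b, c]

/-- The rank-one update by the logarithm vector `(x, y)`: Gram matrix of `log ⊗ log`. -/
abbrev logSq [CommRing K] (x y : K) : Matrix (Fin 2) (Fin 2) K := !![x * x, x * y; y * x, y * y]

/-- **Pencil lemma (rank 2).** The regulator along the height pencil `h_α + t · log⊗log` is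
affine-linear in `t`, with slope `h_α(Q,Q)` for the strict vector `Q = y P₁ − x P₂`. -/
theorem det_pencil [CommRing K] (a b c x y t : K) :
    (gram a b c + t • logSq x y).det = (gram a b c).det + t * (c * x ^ 2 - 2 * b * x * y + a * y ^ 2) := by
  simp only [gram, logSq, Matrix.det_fin_two, Matrix.add_apply, Matrix.smul_apply, smul_eq_mul,
    Matrix.of_apply, Matrix.cons_val', Matrix.cons_val_zero, Matrix.cons_val_one,
    Matrix.cons_val_fin_one, Matrix.empty_val']
  ring

/-- The slope is the `h_α`-self-pairing of the strict vector `Q = (y, -x)` (coordinates w.r.t.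
`P₁, P₂`): `Qᵀ A Q = a y² − 2 b x y + c x²`. -/
theorem slope_eq_strict_self_pairing [CommRing K] (a b c x y : K) :
    c * x ^ 2 - 2 * b * x * y + a * y ^ 2 = ![y, -x] ⬝ᵥ (gram a b c *ᵥ ![y, -x]) := by
  simp [Matrix.mulVec, dotProduct, Fin.sum_univ_two]
  ring

/-- **Total degeneracy of the pencil is codimension two.** Over a field in which `0 ≠ 1`
(any field), every member of the pencil is degenerate iff BOTH the `h_α`-regulator and the
strict self-pairing vanish. -/
theorem pencil_degenerate_iff [Field K] (a b c x y : K) :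
    (∀ t : K, (gram a b c + t • logSq x y).det = 0) ↔
      (gram a b c).det = 0 ∧ c * x ^ 2 - 2 * b * x * y + a * y ^ 2 = 0 := by
  constructor
  · intro h
    have h0 := h 0
    have h1 := h 1
    rw [det_pencil] at h0 h1
    rw [zero_mul, add_zero] at h0
    refine ⟨h0, ?_⟩
    rw [h0, one_mul, zero_add] at h1
    exact h1
  · rintro ⟨hd, hs⟩ t
    rw [det_pencil (K := K), hd, hs]
    ring

/-- **Rank one contrast.** On a line (Gram "matrix" `a`, logarithm `x ≠ 0`) the pencil
`a + t x²` ALWAYS has a degenerate member (`t = -a/x²`): this is why BPS 2018 obtain only a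
disjunction `h_α ≠ 0 ∨ h_β ≠ 0` in rank one and why rank one needs no conjecture there. -/
theorem rank_one_pencil_has_degenerate_member [Field K] (a x : K) (hx : x ≠ 0) :
    ∃ t : K, a + t * x ^ 2 = 0 :=
  ⟨-a / x ^ 2, by field_simp; ring⟩

end Summit.BirchSwinnertonDyer.BirchSwinnertonDyer.Cruxes.SelmerRankUB.IdeateR1K2
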